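import Literature.MathematicalPhysics.QuantumLattice.LatticeGaugeDLRFreeEnergyProofs
import HarnessLib

/-!
# Box geometry for the energy programme (helper E4 of line `Sketch`, crux `FibreToTorus`)

Pure lattice combinatorics on `ℤ^d` used by the lead's proof of "pressure differentiable ⇒
unique action density" (Friedli–Velenik Prop. 6.91 transcribed to lattice gauge theory):
for the box of plaquettes `B_n = [0, n)^d × {planes}` and the box of edges
`Λ_{n+1} = [0, n+1)^d × {directions}`,

1. every plaquette of `B_n` touches `Λ_{n+1}`;
2. every plaquette of `B_n` has all four of its edges in `Λ_{n+1}`;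
3. the plaquettes touching `Λ_{n+1}` but not in `B_n` number at most
   `#planes · ((n+2)^d - n^d)` (every plaquette touching `Λ_{n+1}` is based in `[-1, n+1)^d`).
-/

noncomputable section
open MeasureTheory Filter Topology Finset
open Literature.Probability.LatticeModels (Site halfOpenBox glueWith)
open Literature.MathematicalPhysics.QuantumLattice (LGConfig ZdEdge ZdPlaquette plaquetteObs plaquetteEdges
  plaquettesTouching wilsonBoundaryAction ymSpecification ymGibbsMeasures IsZdTranslationInvariant
  freeEnergyDensity configShift)
open Literature.MathematicalPhysics.QuantumFieldTheory (haarProbability zdHaar)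

namespace Summit.QuantumFields.YangMills.Theorems.FibreToTorus

/-- The edges of a plaquette based in `[0, n)^d` are based in `[0, n+1)^d`. [folklore] -/
private theorem plaquetteEdges_subset_boxEdges {d n : ℕ} {p : ZdPlaquette d}
    (hp : p ∈ (halfOpenBox d n ×ˢ (Finset.univ : Finset {q : Fin d × Fin d // q.1 < q.2}) :
      Finset (ZdPlaquette d))) :
    plaquetteEdges p ⊆ halfOpenBox d (n + 1) ×ˢ (Finset.univ : Finset (Fin d)) := by
  intro e he
  rw [Finset.mem_product] at hp ⊢
  refine ⟨?_, mem_univ _⟩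
  have hp1 := hp.1
  rw [Literature.Probability.LatticeModels.mem_halfOpenBox] at hp1 ⊢
  intro k
  obtain ⟨h1, h2⟩ :=
    Literature.MathematicalPhysics.QuantumFieldTheory.level_bounds_of_mem_plaquetteEdges he k
  obtain ⟨h3, h4⟩ := hp1 k
  push_cast
  constructor <;> omega

/-- Every plaquette touching the edge box `[0, n+1)^d × {directions}` is based in
`[-1, n+1)^d`. [folklore] -/
private theorem plaquettesTouching_boxEdges_subset (d n : ℕ) :
    plaquettesTouching (halfOpenBox d (n + 1) ×ˢ (Finset.univ : Finset (Fin d))) ⊆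
      (Fintype.piFinset fun _ : Fin d => Finset.Ico (-1 : ℤ) ((n : ℤ) + 1)) ×ˢ
        (Finset.univ : Finset {q : Fin d × Fin d // q.1 < q.2}) := by
  intro p hp
  rw [Literature.MathematicalPhysics.QuantumLattice.mem_plaquettesTouching_iff] at hp
  obtain ⟨e, he⟩ := hp
  rw [Finset.mem_inter] at he
  obtain ⟨hep, heΛ⟩ := he
  rw [Finset.mem_product] at heΛ ⊢
  refine ⟨?_, mem_univ _⟩
  have he1 := heΛ.1
  rw [Literature.Probability.LatticeModels.mem_halfOpenBox] at he1
  rw [Fintype.mem_piFinset]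
  intro k
  rw [Finset.mem_Ico]
  obtain ⟨h1, h2⟩ :=
    Literature.MathematicalPhysics.QuantumFieldTheory.level_bounds_of_mem_plaquetteEdges hep k
  obtain ⟨h3, h4⟩ := he1 k
  push_cast at h4
  constructor <;> omega

/-- `#(plaquettesTouching Λ_{n+1}) ≤ #planes · (n+2)^d`. [folklore] -/
private theorem card_plaquettesTouching_boxEdges_le (d n : ℕ) :
    #(plaquettesTouching (halfOpenBox d (n + 1) ×ˢ (Finset.univ : Finset (Fin d)))) ≤
      (n + 2) ^ d * Fintype.card {q : Fin d × Fin d // q.1 < q.2} := by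
  refine (Finset.card_le_card (plaquettesTouching_boxEdges_subset d n)).trans ?_
  rw [Finset.card_product, Fintype.card_piFinset_const, Int.card_Ico, Finset.card_univ]
  have : (((n : ℤ) + 1 - -1).toNat) = n + 2 := by omega
  rw [this]

/-- **Box geometry (E4).** For the plaquette box `B_n = [0, n)^d × {planes}` and the edge box
`Λ_{n+1} = [0, n+1)^d × {directions}`: `B_n ⊆ plaquettesTouching Λ_{n+1}`, every plaquette of
`B_n` has its edges in `Λ_{n+1}`, and
`#(plaquettesTouching Λ_{n+1} \ B_n) ≤ #planes · ((n+2)^d - n^d)`. [folklore] -/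
theorem energy_box_geometry : ∀ (d n : ℕ), (halfOpenBox d n ×ˢ (Finset.univ : Finset {q : Fin d × Fin d // q.1 < q.2}) : Finset (ZdPlaquette d)) ⊆ plaquettesTouching (halfOpenBox d (n + 1) ×ˢ (Finset.univ : Finset (Fin d))) ∧ (∀ p ∈ (halfOpenBox d n ×ˢ (Finset.univ : Finset {q : Fin d × Fin d // q.1 < q.2}) : Finset (ZdPlaquette d)), plaquetteEdges p ⊆ halfOpenBox d (n + 1) ×ˢ (Finset.univ : Finset (Fin d))) ∧ (#(plaquettesTouching (halfOpenBox d (n + 1) ×ˢ (Finset.univ : Finset (Fin d))) \ halfOpenBox d n ×ˢ (Finset.univ : Finset {q : Fin d × Fin d // q.1 < q.2})) : ℝ) ≤ Fintype.card {q : Fin d × Fin d // q.1 < q.2} * (((n : ℝ) + 2) ^ d - (n : ℝ) ^ d) := by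
  intro d n
  have hsub : (halfOpenBox d n ×ˢ (Finset.univ : Finset {q : Fin d × Fin d // q.1 < q.2}) :
      Finset (ZdPlaquette d)) ⊆
      plaquettesTouching (halfOpenBox d (n + 1) ×ˢ (Finset.univ : Finset (Fin d))) := by
    intro p hp
    rw [Literature.MathematicalPhysics.QuantumLattice.mem_plaquettesTouching_iff]
    refine ⟨(p.1, p.2.1.1), Finset.mem_inter.2 ⟨?_, plaquetteEdges_subset_boxEdges hp ?_⟩⟩ <;>
      simp [Literature.MathematicalPhysics.QuantumLattice.plaquetteEdges]
  refine ⟨hsub, fun p hp => plaquetteEdges_subset_boxEdges hp, ?_⟩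
  have hcard := Finset.card_sdiff_add_card_eq_card hsub
  rw [Literature.MathematicalPhysics.QuantumLattice.FreeEnergy.card_boxPlaqs] at hcard
  have hle := card_plaquettesTouching_boxEdges_le d n
  have hR : (#(plaquettesTouching (halfOpenBox d (n + 1) ×ˢ (Finset.univ : Finset (Fin d))) \
      halfOpenBox d n ×ˢ (Finset.univ : Finset {q : Fin d × Fin d // q.1 < q.2})) : ℝ) +
      (n : ℝ) ^ d * Fintype.card {q : Fin d × Fin d // q.1 < q.2} =
      #(plaquettesTouching (halfOpenBox d (n + 1) ×ˢ (Finset.univ : Finset (Fin d)))) := by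
    exact_mod_cast hcard
  have hle' : (#(plaquettesTouching (halfOpenBox d (n + 1) ×ˢ (Finset.univ : Finset (Fin d)))) : ℝ)
      ≤ ((n : ℝ) + 2) ^ d * Fintype.card {q : Fin d × Fin d // q.1 < q.2} := by
    exact_mod_cast hle
  nlinarith [hR, hle']

end Summit.QuantumFields.YangMills.Theorems.FibreToTorus

end
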